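import Literature.NumberTheory.Automorphic.UnitaryRankTwoTorusLocalClassRamifiedBit     -- ★ p843543 B-p12 (g29) FILE 4: `normalForm_bit_readout`, `normalForm_bit_readout_modular`
import Mathlib.NumberTheory.LegendreSymbol.QuadraticChar.Basic
import HarnessLib

/-!
# [LabesseLanglands1979 §2 pp. 8–9; Rogawski1990 §4.9] road «R1-ram» (tamely RAMIFIED place), brick R-3 FILE 6: the unit similitude FLIPS THE BIT —
# conjugating by `diag(1, η)` multiplies the test value by `η`, so the bit of `diag(1,η)·k·diag(1,η)⁻¹` is `1 − e`

Topic `NumberTheory/Automorphic`; namespace `Literature.NumberTheory.Automorphic`.  THEOREMS ONLY (no definition, no instance, no notation, no named fact, no `sorry`).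
Cell `pub/hodgecm-mathlib` (D-0151), crux H413 = `stmt-HodgeConjecture-24833`, line «N6nsGerm», residue `RankOneUnstableTransferNonsplitCMERamified` of #159; LEAD F0P3a-plan (g10);
architect A-p16 (g27) RULINGS A-17 (a) §4 (ii), A-19 (memo (R5b-α) `MEMO-R5b-alpha-RamifiedDepthExpansion.B-p12g29.md` 06d3de01, point (4)); cert 68cf7048 READING (2).
HONEST LABEL: HC_CM is proved only modulo the printed citations (the 2 remaining named inputs hLiu418, h413) until rung 0 closes; nothing printed is asserted here.

MATHEMATICS.  The stable partner of `t` at a ramified place is `Ad_h t`, `h` a similitude with UNIT non-norm multiplier `η` (R-0).  If `Λ = g𝒪²` is `t`-fixed with `gᴴHg = J`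
(`J = J₀` or `ϖJ♯`), then `hΛ` is `Ad_h t`-fixed of the same type and depth, and in the `J`-basis `h·g·diag(1, η⁻¹)` of `hΛ` the matrix of `Ad_h t` is
`k′ = diag(1,η)·k·diag(1,η)⁻¹`, `k = g⁻¹tg`.  For the test value of ★ FILE 4, `T_{k′}(diag(1,η)x) = η·T_k(x)` (`h(Dy, Dx) = η·h(y, x)` for `D = diag(1,η)`, both for `J₀`
and `J♯`), and in the FINITE residue field `η̄·T̄` is a square iff `T̄` is not (`η̄` a non-square): so the bits satisfy **`e + e′ = 1`**.  Heads: **`normalForm_bit_flip`** (edge),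
**`normalForm_bit_flip_modular`** (vertex).  Consequence for (R5b-β): `O(Ad_h t, φ)` is `O(t, φ)` with every window class `c(1+ϖ^i n(η^e))` replaced by `c(1+ϖ^i n(η^{1−e}))`;
deep shells (`i ≥ m`) cancel identically in `O(t,φ) − O(Ad_h t,φ)`.

## References
* [LabesseLanglands1979] J.-P. Labesse, R. P. Langlands, *L-indistinguishability for SL(2)*, Canad. J. Math. 31 (1979): §2, Lemma 2.1, pp. 8–9.
* [Rogawski1990] J. D. Rogawski, *Automorphic Representations of Unitary Groups in Three Variables*, Ann. of Math. Stud. 123 (1990): §4.9 Lemma 4.9.3 p. 56.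
* [Jacobowitz1962] R. Jacobowitz, *Hermitian forms over local fields*, Amer. J. Math. 84 (1962): §4, §8. [Serre1979] J.-P. Serre, *Local Fields* (1979): Ch. V §3.
-/

set_option autoImplicit false

noncomputable section

open scoped ValuativeRel Matrix MatrixGroups
open Matrix ValuativeRel

namespace Literature.NumberTheory.Automorphic

variable {F : Type*} [Field F] [ValuativeRel F]

section Bookkeeping
variable (σ : F →+* F)

omit [ValuativeRel F] in
/-- `(Mv)_r = M_{r0}v₀ + M_{r1}v₁`. [cite: Jacobowitz1962, §4] -/
private theorem mulVec_two_apply' (M : Matrix (Fin 2) (Fin 2) F) (v : Fin 2 → F) (r : Fin 2) : (M *ᵥ v) r = M r 0 * v 0 + M r 1 * v 1 := by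
  show (fun j => M r j) ⬝ᵥ v = _
  rw [Matrix.vec2_dotProduct]

omit [ValuativeRel F] in
/-- The pairing `h(y, z) = Σ_r σ(y_r)(Jz)_r` on `F²`, expanded. [cite: Jacobowitz1962, §4] -/
private theorem pairing_two' (J : Matrix (Fin 2) (Fin 2) F) (y z : Fin 2 → F) :
    (fun r => σ (y r)) ⬝ᵥ (J *ᵥ z) = σ (y 0) * (J 0 0 * z 0 + J 0 1 * z 1) + σ (y 1) * (J 1 0 * z 0 + J 1 1 * z 1) := by
  rw [Matrix.vec2_dotProduct, mulVec_two_apply', mulVec_two_apply']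

omit [ValuativeRel F] in
/-- For an anti-diagonal `J` and σ-fixed `η`: `h(Dy, Dx) = η·h(y, x)`, `D = diag(1, η)`. [cite: Jacobowitz1962, §4] -/
private theorem pairing_diag (J : Matrix (Fin 2) (Fin 2) F) (hJ00 : J 0 0 = 0) (hJ11 : J 1 1 = 0) {η : F} (hση : σ η = η) (y x : Fin 2 → F) :
    (fun r => σ ((!![1, 0; 0, η] *ᵥ y) r)) ⬝ᵥ (J *ᵥ (!![1, 0; 0, η] *ᵥ x)) = η * ((fun r => σ (y r)) ⬝ᵥ (J *ᵥ x)) := by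
  rw [pairing_two', pairing_two']
  simp only [mulVec_two_apply', Matrix.of_apply, Matrix.cons_val', Matrix.cons_val_zero, Matrix.cons_val_one, Matrix.cons_val_fin_one,
    Matrix.empty_val', map_add, map_mul, map_one, map_zero, hση, hJ00, hJ11]
  ring

omit [ValuativeRel F] in
/-- `(DkD′ − c)·(Dx) = D·((k − c)x)` when `D′D = 1`. [cite: Jacobowitz1962, §4] -/
private theorem conj_sub_smul_mulVec (D D' k : Matrix (Fin 2) (Fin 2) F) (hD'D : D' * D = 1) (c : F) (x : Fin 2 → F) :
    (D * k * D' - c • (1 : Matrix (Fin 2) (Fin 2) F)) *ᵥ (D *ᵥ x) = D *ᵥ ((k - c • 1) *ᵥ x) := by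
  have hMD : (D * k * D' - c • (1 : Matrix (Fin 2) (Fin 2) F)) * D = D * (k - c • 1) := by
    rw [Matrix.sub_mul, Matrix.mul_assoc (D * k), hD'D, Matrix.mul_one, Matrix.smul_mul, Matrix.one_mul, Matrix.mul_sub, Matrix.mul_smul,
      Matrix.mul_one]
  rw [Matrix.mulVec_mulVec, hMD, ← Matrix.mulVec_mulVec]

omit [ValuativeRel F] in
/-- In a FINITE field with a non-square `η`: `η·a` is a square iff `a ≠ 0` is not. [cite: Serre1979, Ch. V §3] -/
private theorem isSquare_mul_iff_not {K : Type*} [Field K] [Finite K] {η a : K} (hη : ¬ IsSquare η) (ha : a ≠ 0) :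
    IsSquare (η * a) ↔ ¬ IsSquare a := by
  classical
  haveI := Fintype.ofFinite K
  have hη0 : η ≠ 0 := fun h => hη (h ▸ IsSquare.zero)
  have hχ : quadraticChar K η = -1 := (quadraticChar_neg_one_iff_not_isSquare).2 hη
  rw [← quadraticChar_one_iff_isSquare (mul_ne_zero hη0 ha), map_mul, hχ, ← quadraticChar_neg_one_iff_not_isSquare, neg_one_mul,
    neg_eq_iff_eq_neg]

end Bookkeeping

section Core

variable (σ : F →+* F) {ϖ : F} (hϖ : IsUniformizingElement ϖ) (hσϖ : σ ϖ = -ϖ)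
  (σO : 𝒪[F] →+* 𝒪[F]) (hσO : ∀ x : 𝒪[F], ((σO x : 𝒪[F]) : F) = σ x)

/-- FLIP CORE.  Given the two read-outs (for `k` with bit `e`, for `k′ = DkD′` with bit `e′`; `D = diag(1,η)`, `D′D = 1`, `J` anti-diagonal), a test vector `x` for `k`
with `|T_k(x)| = 1`, and `T_{k′}(Dx) = η·T_k(x)`: then `e + e′ = 1`. [cite: LabesseLanglands1979, §2 pp. 8–9] [cite: Serre1979, Ch. V §3] -/
private theorem flip_core [Finite (IsLocalRing.ResidueField 𝒪[F])]
    {η : 𝒪[F]} (hη : ¬ IsSquare (IsLocalRing.residue 𝒪[F] η)) {e e' : ℕ} (he : e ≤ 1) (he' : e' ≤ 1)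
    {T T' : F} (hTO : T ∈ 𝒪[F]) (hT1 : valuation F T = 1) (hT'O : T' ∈ 𝒪[F]) (hTT' : T' = ((η : 𝒪[F]) : F) * T)
    (hread : ∀ TO : 𝒪[F], (TO : F) = T → IsUnit TO → (IsSquare (IsLocalRing.residue 𝒪[F] TO) ↔ e = 0))
    (hread' : ∀ TO : 𝒪[F], (TO : F) = T' → IsUnit TO → (IsSquare (IsLocalRing.residue 𝒪[F] TO) ↔ e' = 0)) : e + e' = 1 := by
  have hTu : IsUnit (⟨T, hTO⟩ : 𝒪[F]) := (Valuation.integer.integers (valuation F)).isUnit_iff_valuation_eq_one.2 hT1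
  have hηu : IsUnit η := by
    rw [← IsLocalRing.residue_ne_zero_iff_isUnit]; exact fun h => hη (h ▸ IsSquare.zero)
  have heq : (⟨T', hT'O⟩ : 𝒪[F]) = η * ⟨T, hTO⟩ := Subtype.ext (by simpa using hTT')
  have hT'u : IsUnit (⟨T', hT'O⟩ : 𝒪[F]) := by rw [heq]; exact hηu.mul hTu
  have h1 := hread ⟨T, hTO⟩ rfl hTu
  have h2 := hread' ⟨T', hT'O⟩ rfl hT'u
  rw [heq, map_mul, isSquare_mul_iff_not hη ((IsLocalRing.residue_ne_zero_iff_isUnit _).2 hTu), h1] at h2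
  omega

include hϖ hσϖ hσO in
/-- **THE SIMILITUDE FLIPS THE BIT (edge ∕ `J₀`).**  In the setting of ★ `normalForm_bit_readout` (normal form of `k` with bit `e`, window `m`), suppose the conjugate
`k′ := diag(1,η)·k·diag(1,η⁻¹)` — the matrix of `Ad_h t` at `hΛ` in a `J₀`-basis, `h` the unit similitude of multiplier `η` — is ALSO in normal form (some `κ′, R′`, window
`m′`, same depth `i`, bit `e′`).  Then `e + e′ = 1`.  (Residue field finite.) [cite: LabesseLanglands1979, §2 Lemma 2.1 pp. 8–9] [cite: Rogawski1990, §4.9 Lemma 4.9.3 p. 56]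
[cite: Jacobowitz1962, §8] [cite: Serre1979, Ch. V §3] -/
theorem normalForm_bit_flip [Finite (IsLocalRing.ResidueField 𝒪[F])]
    (hres : ∀ x : 𝒪[F], σO x - x ∈ IsLocalRing.maximalIdeal 𝒪[F])
    {η : 𝒪[F]} (hηu : IsUnit η) (hση : σO η = η) (hη : ¬ IsSquare (IsLocalRing.residue 𝒪[F] η))
    {k κ R κ' R' : Matrix (Fin 2) (Fin 2) F} (hκO : ∀ r s, κ r s ∈ 𝒪[F]) (hκU : (κ.map σ)ᵀ * !![0, 1; 1, 0] * κ = !![0, 1; 1, 0])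
    (hRO : ∀ r s, R r s ∈ 𝒪[F]) (hκ'O : ∀ r s, κ' r s ∈ 𝒪[F]) (hκ'U : (κ'.map σ)ᵀ * !![0, 1; 1, 0] * κ' = !![0, 1; 1, 0])
    (hR'O : ∀ r s, R' r s ∈ 𝒪[F]) {c : F} (hc : σ c * c = 1) (hc1 : valuation F c = 1)
    {i m m' : ℕ} (him : i < m) (him' : i < m') (hi : Odd i) {e e' : ℕ} (he : e ≤ 1) (he' : e' ≤ 1)
    (hnf : !![0, 1; 1, 0] * (κ.map σ)ᵀ * !![0, 1; 1, 0] * k * κ = c • (1 + ϖ ^ i • !![0, ((η : 𝒪[F]) : F) ^ e; 0, 0]) + ϖ ^ m • R)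
    (hnf' : !![0, 1; 1, 0] * (κ'.map σ)ᵀ * !![0, 1; 1, 0] * (!![1, 0; 0, ((η : 𝒪[F]) : F)] * k * !![1, 0; 0, ((η : 𝒪[F]) : F)⁻¹]) * κ' =
      c • (1 + ϖ ^ i • !![0, ((η : 𝒪[F]) : F) ^ e'; 0, 0]) + ϖ ^ m' • R') :
    e + e' = 1 := by
  have hηF0 : ((η : 𝒪[F]) : F) ≠ 0 := by
    have h := (Valuation.integer.integers (valuation F)).isUnit_iff_valuation_eq_one.1 hηu
    intro h0; rw [show (algebraMap 𝒪[F] F) η = ((η : 𝒪[F]) : F) from rfl, h0, map_zero] at h; exact zero_ne_one h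
  have hσηF : σ ((η : 𝒪[F]) : F) = ((η : 𝒪[F]) : F) := by rw [← hσO, hση]
  obtain ⟨hall, x, hx, hTx⟩ := normalForm_bit_readout σ hϖ hσϖ σO hσO hres hηu hση hη hκO hκU hRO hc hc1 him hi he hnf
  obtain ⟨hall', -⟩ := normalForm_bit_readout σ hϖ hσϖ σO hσO hres hηu hση hη hκ'O hκ'U hR'O hc hc1 him' hi he' hnf'
  obtain ⟨hTO, hread⟩ := hall x hx
  have hx' : ∀ r, (!![1, 0; 0, ((η : 𝒪[F]) : F)] *ᵥ x) r ∈ 𝒪[F] := by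
    refine Fin.forall_fin_two.2 ⟨?_, ?_⟩
    · rw [mulVec_two_apply']; simpa using hx 0
    · rw [mulVec_two_apply']; simpa using (𝒪[F]).mul_mem η.2 (hx 1)
  obtain ⟨hT'O, hread'⟩ := hall' _ hx'
  have hD'D : (!![1, 0; 0, ((η : 𝒪[F]) : F)⁻¹] : Matrix (Fin 2) (Fin 2) F) * !![1, 0; 0, ((η : 𝒪[F]) : F)] = 1 := by
    rw [Matrix.mul_fin_two, Matrix.one_fin_two, inv_mul_cancel₀ hηF0]; norm_num
  have hTT' : -c * ϖ ^ (-(i : ℤ)) * ((fun r => σ (((!![1, 0; 0, ((η : 𝒪[F]) : F)] * k * !![1, 0; 0, ((η : 𝒪[F]) : F)⁻¹] - c • 1) *ᵥ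
        (!![1, 0; 0, ((η : 𝒪[F]) : F)] *ᵥ x)) r)) ⬝ᵥ (!![0, 1; 1, 0] *ᵥ (!![1, 0; 0, ((η : 𝒪[F]) : F)] *ᵥ x))) =
      ((η : 𝒪[F]) : F) * (-c * ϖ ^ (-(i : ℤ)) * ((fun r => σ (((k - c • 1) *ᵥ x) r)) ⬝ᵥ (!![0, 1; 1, 0] *ᵥ x))) := by
    rw [conj_sub_smul_mulVec _ _ k hD'D, pairing_diag σ !![0, 1; 1, 0] (by simp) (by simp) hσηF]; ring
  exact flip_core hη he he' hTO hTx hT'O hTT' hread hread'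

include hϖ hσϖ hσO in
/-- **THE SIMILITUDE FLIPS THE BIT (vertex ∕ `J♯`).**  As `normalForm_bit_flip`, in the setting of ★ `normalForm_bit_readout_modular` (`J♯ = [[0,−1],[1,0]]`, even `i`).
[cite: LabesseLanglands1979, §2 Lemma 2.1 pp. 8–9] [cite: Rogawski1990, §4.9 Lemma 4.9.3 p. 56] [cite: Jacobowitz1962, §8] [cite: Serre1979, Ch. V §3] -/
theorem normalForm_bit_flip_modular [Finite (IsLocalRing.ResidueField 𝒪[F])]
    (hres : ∀ x : 𝒪[F], σO x - x ∈ IsLocalRing.maximalIdeal 𝒪[F])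
    {η : 𝒪[F]} (hηu : IsUnit η) (hση : σO η = η) (hη : ¬ IsSquare (IsLocalRing.residue 𝒪[F] η))
    {k κ R κ' R' : Matrix (Fin 2) (Fin 2) F} (hκO : ∀ r s, κ r s ∈ 𝒪[F]) (hκU : (κ.map σ)ᵀ * !![0, -1; 1, 0] * κ = !![0, -1; 1, 0])
    (hRO : ∀ r s, R r s ∈ 𝒪[F]) (hκ'O : ∀ r s, κ' r s ∈ 𝒪[F]) (hκ'U : (κ'.map σ)ᵀ * !![0, -1; 1, 0] * κ' = !![0, -1; 1, 0])
    (hR'O : ∀ r s, R' r s ∈ 𝒪[F]) {c : F} (hc : σ c * c = 1) (hc1 : valuation F c = 1)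
    {i m m' : ℕ} (him : i < m) (him' : i < m') (hi : Even i) {e e' : ℕ} (he : e ≤ 1) (he' : e' ≤ 1)
    (hnf : !![0, 1; -1, 0] * (κ.map σ)ᵀ * !![0, -1; 1, 0] * k * κ = c • (1 + ϖ ^ i • !![0, ((η : 𝒪[F]) : F) ^ e; 0, 0]) + ϖ ^ m • R)
    (hnf' : !![0, 1; -1, 0] * (κ'.map σ)ᵀ * !![0, -1; 1, 0] * (!![1, 0; 0, ((η : 𝒪[F]) : F)] * k * !![1, 0; 0, ((η : 𝒪[F]) : F)⁻¹]) * κ' =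
      c • (1 + ϖ ^ i • !![0, ((η : 𝒪[F]) : F) ^ e'; 0, 0]) + ϖ ^ m' • R') :
    e + e' = 1 := by
  have hηF0 : ((η : 𝒪[F]) : F) ≠ 0 := by
    have h := (Valuation.integer.integers (valuation F)).isUnit_iff_valuation_eq_one.1 hηu
    intro h0; rw [show (algebraMap 𝒪[F] F) η = ((η : 𝒪[F]) : F) from rfl, h0, map_zero] at h; exact zero_ne_one h
  have hσηF : σ ((η : 𝒪[F]) : F) = ((η : 𝒪[F]) : F) := by rw [← hσO, hση]
  obtain ⟨hall, x, hx, hTx⟩ := normalForm_bit_readout_modular σ hϖ hσϖ σO hσO hres hηu hση hη hκO hκU hRO hc hc1 him hi he hnf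
  obtain ⟨hall', -⟩ := normalForm_bit_readout_modular σ hϖ hσϖ σO hσO hres hηu hση hη hκ'O hκ'U hR'O hc hc1 him' hi he' hnf'
  obtain ⟨hTO, hread⟩ := hall x hx
  have hx' : ∀ r, (!![1, 0; 0, ((η : 𝒪[F]) : F)] *ᵥ x) r ∈ 𝒪[F] := by
    refine Fin.forall_fin_two.2 ⟨?_, ?_⟩
    · rw [mulVec_two_apply']; simpa using hx 0
    · rw [mulVec_two_apply']; simpa using (𝒪[F]).mul_mem η.2 (hx 1)
  obtain ⟨hT'O, hread'⟩ := hall' _ hx'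
  have hD'D : (!![1, 0; 0, ((η : 𝒪[F]) : F)⁻¹] : Matrix (Fin 2) (Fin 2) F) * !![1, 0; 0, ((η : 𝒪[F]) : F)] = 1 := by
    rw [Matrix.mul_fin_two, Matrix.one_fin_two, inv_mul_cancel₀ hηF0]; norm_num
  have hTT' : -c * ϖ ^ (-(i : ℤ)) * ((fun r => σ (((!![1, 0; 0, ((η : 𝒪[F]) : F)] * k * !![1, 0; 0, ((η : 𝒪[F]) : F)⁻¹] - c • 1) *ᵥ
        (!![1, 0; 0, ((η : 𝒪[F]) : F)] *ᵥ x)) r)) ⬝ᵥ (!![0, -1; 1, 0] *ᵥ (!![1, 0; 0, ((η : 𝒪[F]) : F)] *ᵥ x))) =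
      ((η : 𝒪[F]) : F) * (-c * ϖ ^ (-(i : ℤ)) * ((fun r => σ (((k - c • 1) *ᵥ x) r)) ⬝ᵥ (!![0, -1; 1, 0] *ᵥ x))) := by
    rw [conj_sub_smul_mulVec _ _ k hD'D, pairing_diag σ !![0, -1; 1, 0] (by simp) (by simp) hσηF]; ring
  exact flip_core hη he he' hTO hTx hT'O hTT' hread hread'

end Core

end Literature.NumberTheory.Automorphic

end
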